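import Literature.MathematicalPhysics.QuantumFieldTheory.Balaban1983to89.T4CauchySum

/-!
# Sketch — crux idea `age-scale-convolution` (seat ym-nodeO-idea-3 g5, lens `complete`, crux K3⁷
`Summit.QuantumFields.YangMills.Theses.BalabanUVNodes.SpineGivenEndpointR13SepCoPH`, item stmt-QuantumFields-20544).

HONESTY.  Nothing here proves or approaches the Yang–Mills mass gap (Clay); `route-QuantumFields-BalabanUVNodes.closes`
concludes only the CONDITIONAL finite-𝕋⁴ rung `BalabanLadder.UV`; [B12] Thm 2 is unproved in print; nothing of Bałaban
is asserted.  Every `def … : Prop` below is a HYPOTHESIS SHAPE or the STATEMENT of an elementary lemma (not proved here —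
planners do not prove); the two `example`s are definitional sanity checks (`rfl`-grade).

THE LEVER (words).  In the two-run comparison behind the N19′ core edge (`K3Skeleton13SepCoPHV5.KeyedCoreEdgeHolderD4`,
`NE7.Core … δ ∧ Summable δ`) the healed-LARGE-FIELD channel carries, at AGE `n` (= number of remaining scales), the
activity `a n = exp(−c₀·p₀(g at age n)²) = exp(−c·(log(g⁻² + b·n))^{2p₀})` — summable in `n` with all polynomial
moments but NOT geometric ([III] CMP 119 p.244/246: `p₀(g) = A₀ (log g⁻²)^{p₀}`; [IV] CMP 122 p.175: "does not give any
positive power of ε") — while the discrepancy injected at SCALE-FROM-BIRTH `j` is geometric `≤ C (K+1)^c θ^j` (tree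
`T4CouplingMatching.disc_le_of_fadingMemory`, `T4CauchySum.InjectedRate`).  Since `K = j + n`, the channel's total is
the antidiagonal CONVOLUTION `Σ_{j+n=K} inj K j · a n` — summable in `K` by the discrete Young inequality.  Node U6's
`T4CauchySum.delta E ρ inj` hard-codes the geometric transport `ρ^n`; `deltaT` below is its ℓ¹-TRANSPORT edition, and
`delta` is the instance `t n = ρ^n`.

EDITION 2 (g8, 2026-08-28) — ERRATUM.  At the record's FULL-history key (the key v5's `PinnedAtLive` pins) the `t`-INDEPENDENT
two-run vacuum channel is EXTENSIVE in the old-large-field volume, so no class-uniform `LFChannelBound` with one `E` per `K` can hold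
there (companion `Sketch2.lean`, `YMNodeOIdeate.Idea3.WindowKeyCore.caricature_not_coreEdge`, kernel, via
`N19HybridBeyondTarget.not_coreEdge_of_unsummable_gap`); the shapes below are to be read at Bałaban's 𝐑-WINDOW key ([LF-II] (1.80)
p.384), young ages only, where the large-field share of the `Core` radius is the geometric `WindowKeyCore.windowBudget` and the
activity enters N20's weight face, not `δ`.  `FirstLemma`/`SecondLemma`/`NotGeometric`/`ThirdLemma` were PROVED in tree by dag-n19-w1
(p603780 `…N19AgeScaleTransportBudget`); they remain true and harmless.
-/

namespace YMNodeOIdeate.Idea3.AgeScaleConvolution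

open Finset
open Literature.MathematicalPhysics.QuantumFieldTheory.Balaban1983to89

/-- ℓ¹-TRANSPORT EDITION of node U6's transported total: a discrepancy `inj K j` injected at scale `j` reaches the
last scale multiplied by a transport/activity factor `t n` of the AGE `n = K − j` (geometric `ρ^n` in the small-field
channel = `T4CauchySum.delta`; the quasi-polynomial large-field activity `a n` in the healed-large-field channel). -/
noncomputable def deltaT (E : ℝ) (t : ℕ → ℝ) (inj : ℕ → ℕ → ℝ) (K : ℕ) : ℝ :=
  E * ∑ p ∈ antidiagonal K, inj K p.1 * t p.2

/-- Sanity: node U6's `delta` IS the geometric instance of `deltaT`. -/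
example (E ρ : ℝ) (inj : ℕ → ℕ → ℝ) (K : ℕ) :
    T4CauchySum.delta E ρ inj K = deltaT E (fun n => ρ ^ n) inj K := rfl

/-- HYPOTHESIS SHAPE — an AGE-summable transport: `t ≥ 0` with all moments up to order `c` summable
(`c` = the asymptotic-freedom exponent of `InjectedRate C c θ`). -/
def SummableTransport (c : ℕ) (t : ℕ → ℝ) : Prop :=
  (∀ n, 0 ≤ t n) ∧ Summable fun n : ℕ => ((n : ℝ) + 1) ^ c * t n

/-- FIRST LEMMA (statement; elementary — discrete Young / Mertens for nonnegative series, using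
`(j+n+1)^c ≤ 2^c((j+1)^c + (n+1)^c)`): a GEOMETRIC injected rate convolved with an ℓ¹ (moment-`c`) transport is
summable in `K`.  The tree's `T4CauchySum.summable_delta` is the special case `t n = ρ^n`, `0 ≤ ρ < 1`. -/
def FirstLemma : Prop :=
  ∀ (E C θ : ℝ) (c : ℕ) (t : ℕ → ℝ) (inj : ℕ → ℕ → ℝ),
    0 ≤ E → 0 ≤ C → 0 ≤ θ → θ < 1 → T4CauchySum.InjectedRate C c θ inj → SummableTransport c t →
      Summable (deltaT E t inj)

/-- Bałaban's healed-large-field ACTIVITY read in AGE: with `1/g² ≈ 1/g_∞² + b·n` along the asymptotically free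
trajectory ((0.20) of [B12]) and `p₀(g) = A₀ (log g⁻²)^{p₀}` ([III] (1.1) p.244 / line after (1.8) p.246),
`exp(−c₀ p₀(g)²) = exp(−c₀ A₀² (log(x₀ + b n))^{2 p₀})`.  Parameters: `A = √c₀·A₀`, `x₀ = g_∞⁻² > 1`, `b > 0`. -/
noncomputable def balabanActivity (A x₀ b : ℝ) (p₀ : ℕ) (n : ℕ) : ℝ :=
  Real.exp (-((A * Real.log (x₀ + b * n)) ^ (2 * p₀)))

/-- SECOND LEMMA (statement; elementary): the activity is an AGE-summable transport for EVERY moment order `c`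
(it decays faster than any power: `exp(−A² log²(x₀+bn)) = (x₀+bn)^{−A² log(x₀+bn)}`), although it is NOT
`O(θ^n)` for any `θ < 1` — which is why node U6's geometric `delta` cannot host this channel. -/
def SecondLemma : Prop :=
  ∀ (A x₀ b : ℝ) (p₀ c : ℕ), 0 < A → 1 < x₀ → 0 < b → 1 ≤ p₀ → SummableTransport c (balabanActivity A x₀ b p₀)

/-- NEGATIVE HALF of the second lemma (statement): the activity is not geometrically small — for every `θ ∈ ]0,1[`
and `M`, eventually `balabanActivity … n > M θ^n`.  (So `InjectedRate`-with-`ρ^n` typings of this channel are FALSE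
as hypotheses about Bałaban's scheme, while the ℓ¹ typing is what print supports.) -/
def NotGeometric : Prop :=
  ∀ (A x₀ b : ℝ) (p₀ : ℕ), 0 < A → 1 < x₀ → 0 < b → 1 ≤ p₀ →
    ∀ θ M : ℝ, 0 < θ → θ < 1 → ∃ N : ℕ, ∀ n ≥ N, M * θ ^ n < balabanActivity A x₀ b p₀ n

/-- HYPOTHESIS SHAPE — the LARGE-FIELD CHANNEL BOUND the line would prove (physics; NOT in print): the healed-large-
field part `δLF K` of the two-run core discrepancy at `K` steps is majorised by volume × [convolution of the scale-
geometric injected discrepancy `u` with the age-activity `a`, plus the unmatched BIRTH-scale activity `a (K+1)` of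
run B].  Entropy `L^{4n}` of age-`n` blocks per unit volume against locality dilution `L^{−4n}` of their effect on
BLOCK-AVERAGED unit-scale observables is the cancellation that makes the majorant volume × (dimensionless). -/
def LFChannelBound (vol E : ℝ) (u a δLF : ℕ → ℝ) : Prop :=
  ∀ K, 0 ≤ δLF K ∧ δLF K ≤ vol * (E * (∑ p ∈ antidiagonal K, u p.1 * a p.2) + a (K + 1))

/-- THIRD LEMMA (statement; elementary corollary of the first with `c = 0`): an LF-channel bound with `u, a ∈ ℓ¹₊`
gives `Summable δLF` — exactly the currency `NE7.Core … δ ∧ Summable δ` / `HybridNE7.summable` consumes. -/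
def ThirdLemma : Prop :=
  ∀ (vol E : ℝ) (u a δLF : ℕ → ℝ), 0 ≤ vol → 0 ≤ E → (∀ j, 0 ≤ u j) → Summable u → (∀ n, 0 ≤ a n) → Summable a →
    LFChannelBound vol E u a δLF → Summable δLF

/-- CHANNEL SPLIT SHAPE (what the line's composition stub would discharge): the core-edge `δ` of
`K3Skeleton13SepCoPHV5.KeyedCoreEdgeHolderD4` is served by ANY `δ ≥ δSF + δLF` with both halves summable — the
small-field half through node U6's geometric `T4CauchySum.summable_delta`, the large-field half through `ThirdLemma`. -/
def CoreDeltaSplit (δ δSF δLF : ℕ → ℝ) : Prop :=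
  (∀ K, δSF K + δLF K ≤ δ K) ∧ Summable δSF ∧ Summable δLF

/-- Sanity: the split shape is inhabited by the sum itself. -/
example (δSF δLF : ℕ → ℝ) (h₁ : Summable δSF) (h₂ : Summable δLF) :
    CoreDeltaSplit (fun K => δSF K + δLF K) δSF δLF := ⟨fun _ => le_rfl, h₁, h₂⟩

end YMNodeOIdeate.Idea3.AgeScaleConvolution
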